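import Mathlib
import Literature.NumberTheory.Sieve.BatemanHornProofs
import Literature.NumberTheory.Sieve.ParityWave0BunyakovskyProofs
import Summits.Parity.BatemanHorn.Theorems.IsogenyRedeiPolyMobiusTailStubEventuallyTwoLe
import Summits.Parity.BatemanHorn.Theorems.PolyMobiusTail.Negative.Structure
import Summits.Parity.BatemanHorn.Theorems.IsogenyRedeiPolyMobiusTailStubSignedTypeIOfKernelAux

/-!
# Crux `PolyMobiusTail` (stmt-Parity-0870), line `Sketch` (natural form): stub `stub_signedTypeI_of_kernel`

Bookkeeping: GIVEN the kernel bound (hypothesis), for a Bateman–Horn system, `η ∈ (1/2,1)` and non-empty `S`,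
`Σ_{n≤x} (∏_{i∈S} log fᵢ(n)) · Σ_{dᵢ∣fᵢ(n), ∏dᵢ ≤ x^{1-η}} (∏μ(dᵢ)) ∏_{i∉S} log dᵢ = o(x)`.

Proof (all analytic input is in the hypothesis): choose `N₀` with `fᵢ(n) ≥ 2` and `n ↦ fᵢ(n)` non-decreasing
for `n ≥ N₀` (`signedTypeI_threshold`); the `n < N₀` contribute `O(1)` (`signedTypeI_initial_le`); for
`n ≥ N₀` the divisor tuples with `∏ dᵢ ≤ y = x^{1-η}` live in the box `[1, ⌊y⌋]^k`
(`signedTypeI_divisor_sum_eq`); swapping the sums, the pattern `dᵢ ∣ fᵢ(n)` is `∏dᵢ`-periodic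
(`signedTypeI_periodic`) and the weight `W(n) = ∏_{i∈S} log fᵢ(n)` is monotone, so each inner sum is
`(ρ_d/∏dᵢ) Σ W + O(ρ_d W(x))` (`SignedTypeIAux.core_estimate`); the main term is `(Σ W) · V_S(y)` with
`|V_S(y)| ≤ C/(log y)^{|S|+1}` by the kernel hypothesis, i.e. `O(x / log x)`, and the error is
`O(y² (log y)^{2k} (log x)^{|S|}) = O(x^{2-2η} polylog x) = o(x)` because `η > 1/2`
(`SignedTypeIAux.box_error_sum_le`, `SignedTypeIAux.isLittleO_model`).

Registered stub of the lead's skeleton `Summits/Parity/BatemanHorn/Cruxes/PolyMobiusTail/Lines/Sketch.lean`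
(namespace `Summit.Parity.BatemanHorn.Cruxes.PolyMobiusTail.NaturalForm`); the statement below is the
registered signature VERBATIM (inline sums, no definitions) and must not be edited.
-/

open scoped BigOperators
open Filter Finset Polynomial Asymptotics

namespace Summit.Parity.BatemanHorn.Theorems.PolyMobiusTail.NaturalForm

open Literature.NumberTheory.Sieve (IsBatemanHornSystem)
open SignedTypeIAux

/-- A common threshold `N₀ ≥ 3`: beyond it every `fᵢ(n).toNat ≥ 2` and every `n ↦ fᵢ(n)` is
non-decreasing. [folklore] -/
theorem signedTypeI_threshold {k : ℕ} {f : Fin k → ℤ[X]} (hf : IsBatemanHornSystem f) :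
    ∃ N₀ : ℕ, 3 ≤ N₀ ∧ (∀ n, N₀ ≤ n → ∀ i, 2 ≤ ((f i).eval (n : ℤ)).toNat) ∧
      ∀ i (m n : ℕ), N₀ ≤ m → m ≤ n → (f i).eval (m : ℤ) ≤ (f i).eval (n : ℤ) := by
  obtain ⟨N₁, hN₁⟩ := stub_eventually_two_le k f hf
  have hmono : ∀ i, ∃ N : ℕ, ∀ m n : ℕ, N ≤ m → m ≤ n → (f i).eval (m : ℤ) ≤ (f i).eval (n : ℤ) :=
    fun i => exists_monotone_eval (f i) (Nat.succ_le_of_lt (hf.natDegree_pos i))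
      (hf.leadingCoeff_pos i)
  choose N hN using hmono
  refine ⟨max 3 (max N₁ (Finset.univ.sup N)), le_max_left _ _, fun n hn i => hN₁ n ?_ i,
    fun i m n hm hmn => hN i m n ?_ hmn⟩
  · exact (le_max_left _ _).trans ((le_max_right _ _).trans hn)
  · exact (Finset.le_sup (Finset.mem_univ i)).trans
      ((le_max_right _ _).trans ((le_max_right _ _).trans hm))

/-- Logarithmic growth of the values: `log fᵢ(n).toNat ≤ K log n` for `n ≥ 2`, with one `K` for
all `i` (from `fᵢ(n).toNat ≤ (Σ|aᵢⱼ|) n^{deg fᵢ} ≤ n^{Σ|aᵢⱼ| + deg fᵢ}`). [folklore] -/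
theorem signedTypeI_log_toNat_eval_le {k : ℕ} (f : Fin k → ℤ[X]) :
    ∃ K : ℕ, ∀ n : ℕ, 2 ≤ n → ∀ i,
      Real.log ((((f i).eval (n : ℤ)).toNat : ℕ) : ℝ) ≤ K * Real.log n := by
  set B : Fin k → ℕ := fun i => ∑ j ∈ Finset.range ((f i).natDegree + 1), ((f i).coeff j).natAbs
    with hB
  refine ⟨∑ i, (B i + (f i).natDegree), fun n hn i => ?_⟩
  have hle : ((f i).eval (n : ℤ)).toNat ≤ n ^ (∑ i, (B i + (f i).natDegree)) := by
    calc ((f i).eval (n : ℤ)).toNat ≤ B i * n ^ (f i).natDegree :=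
          Negative.toNat_eval_le_mul_pow (f i) (by omega)
      _ ≤ n ^ (B i) * n ^ (f i).natDegree := by
          gcongr
          exact Nat.lt_two_pow_self.le.trans (Nat.pow_le_pow_left hn _)
      _ = n ^ (B i + (f i).natDegree) := by rw [pow_add]
      _ ≤ n ^ (∑ i, (B i + (f i).natDegree)) :=
          Nat.pow_le_pow_right (by omega)
            (Finset.single_le_sum (f := fun j => B j + (f j).natDegree) (fun j _ => Nat.zero_le _)
              (Finset.mem_univ i))
  rcases Nat.eq_zero_or_pos ((f i).eval (n : ℤ)).toNat with h0 | hpos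
  · rw [h0, Nat.cast_zero, Real.log_zero]
    exact mul_nonneg (Nat.cast_nonneg _) (Real.log_nonneg (by exact_mod_cast (by omega : 1 ≤ n)))
  · calc Real.log ((((f i).eval (n : ℤ)).toNat : ℕ) : ℝ)
        ≤ Real.log ((n : ℝ) ^ (∑ i, (B i + (f i).natDegree))) := by
          refine Real.log_le_log (by exact_mod_cast hpos) ?_
          exact_mod_cast hle
      _ = _ := by rw [Real.log_pow]

/-- At an argument `n` where all `fᵢ(n) ≥ 1`, the truncated divisor-tuple sum is a sum over the fixed
box `[1, ⌊y⌋]^k` against the indicator of `dᵢ ∣ fᵢ(n)` (divisor tuples outside the box have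
`∏ dᵢ > y`). [folklore] -/
theorem signedTypeI_divisor_sum_eq {k : ℕ} (f : Fin k → ℤ[X]) (w : (Fin k → ℕ) → ℝ) {n : ℕ}
    (hn : ∀ i, 1 ≤ ((f i).eval (n : ℤ)).toNat) (y : ℝ) :
    (∑ d ∈ Fintype.piFinset (fun i => (((f i).eval (n : ℤ)).toNat).divisors),
        if ∏ i, (d i : ℝ) ≤ y then w d else 0)
      = ∑ d ∈ Fintype.piFinset (fun _ : Fin k => Icc 1 ⌊y⌋₊),
        if ∏ i, (d i : ℝ) ≤ y then
          w d * (if (∀ i, ((d i : ℕ) : ℤ) ∣ (f i).eval (n : ℤ)) then 1 else 0) else 0 := by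
  have hcast : ∀ i, (f i).eval (n : ℤ) = ((((f i).eval (n : ℤ)).toNat : ℕ) : ℤ) := fun i =>
    (Int.toNat_of_nonneg (by have := hn i; omega)).symm
  have hdvd : ∀ (d : Fin k → ℕ) i,
      (((d i : ℕ) : ℤ) ∣ (f i).eval (n : ℤ)) ↔ d i ∣ ((f i).eval (n : ℤ)).toNat := by
    intro d i
    constructor
    · intro h
      rwa [hcast i, Int.natCast_dvd_natCast] at h
    · intro h
      rw [hcast i, Int.natCast_dvd_natCast]
      exact h
  have hR : (∑ d ∈ Fintype.piFinset (fun _ : Fin k => Icc 1 ⌊y⌋₊),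
        if ∏ i, (d i : ℝ) ≤ y then
          w d * (if (∀ i, ((d i : ℕ) : ℤ) ∣ (f i).eval (n : ℤ)) then 1 else 0) else 0)
      = ∑ d ∈ (Fintype.piFinset (fun _ : Fin k => Icc 1 ⌊y⌋₊)).filter
          (fun d => ∀ i, ((d i : ℕ) : ℤ) ∣ (f i).eval (n : ℤ)),
        if ∏ i, (d i : ℝ) ≤ y then w d else 0 := by
    rw [Finset.sum_filter]
    refine Finset.sum_congr rfl fun d _ => ?_
    split_ifs <;> ring
  rw [hR]
  refine (Finset.sum_subset (fun d hd => ?_) (fun d hd hd' => ?_)).symm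
  · obtain ⟨hB, hP⟩ := Finset.mem_filter.mp hd
    refine Fintype.mem_piFinset.mpr fun i => Nat.mem_divisors.mpr ⟨(hdvd d i).mp (hP i), ?_⟩
    have := hn i
    omega
  · have hdi : ∀ i, d i ∣ ((f i).eval (n : ℤ)).toNat ∧ ((f i).eval (n : ℤ)).toNat ≠ 0 :=
      fun i => Nat.mem_divisors.mp (Fintype.mem_piFinset.mp hd i)
    have hd1 : ∀ i, 1 ≤ d i := fun i =>
      Nat.pos_of_dvd_of_pos (hdi i).1 (Nat.pos_of_ne_zero (hdi i).2)
    have hP : ∀ i, ((d i : ℕ) : ℤ) ∣ (f i).eval (n : ℤ) := fun i => (hdvd d i).mpr (hdi i).1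
    have hBox : d ∉ Fintype.piFinset (fun _ : Fin k => Icc 1 ⌊y⌋₊) := fun hB =>
      hd' (Finset.mem_filter.mpr ⟨hB, hP⟩)
    obtain ⟨i, hi⟩ := not_forall.mp (fun h => hBox (Fintype.mem_piFinset.mpr h))
    rw [mem_Icc, not_and_or, not_le, not_le] at hi
    have hlt : y < (d i : ℝ) := Nat.lt_of_floor_lt (hi.resolve_left (by have := hd1 i; omega))
    have hle : (d i : ℝ) ≤ ∏ j, (d j : ℝ) := by
      rw [← Nat.cast_prod]
      exact_mod_cast Finset.single_le_prod' (fun j _ => hd1 j) (Finset.mem_univ i)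
    rw [if_neg (by linarith)]

/-- Bookkeeping for the finitely many initial `n < N₀`: a bound independent of `x` and `y`.
[folklore] -/
theorem signedTypeI_initial_le (F : ℕ → ℝ → ℝ) (G : ℕ → ℝ) (hFG : ∀ n y, |F n y| ≤ G n)
    (N₀ x : ℕ) (y : ℝ) :
    |∑ n ∈ (Icc 1 x).filter (fun n => n < N₀), F n y| ≤ ∑ n ∈ range N₀, G n :=
  calc |∑ n ∈ (Icc 1 x).filter (fun n => n < N₀), F n y|
      ≤ ∑ n ∈ (Icc 1 x).filter (fun n => n < N₀), |F n y| := Finset.abs_sum_le_sum_abs _ _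
    _ ≤ ∑ n ∈ (Icc 1 x).filter (fun n => n < N₀), G n := Finset.sum_le_sum fun n _ => hFG n y
    _ ≤ ∑ n ∈ range N₀, G n :=
        Finset.sum_le_sum_of_subset_of_nonneg
          (fun _ hn => mem_range.mpr (Finset.mem_filter.mp hn).2)
          fun n _ _ => (abs_nonneg _).trans (hFG n y)

/-- The coefficients `w(d) = (∏ μ(dᵢ)) ∏_{i ∉ S} log dᵢ` are bounded by `(1 + log y)^k` on the box
`[1, ⌊y⌋]^k`. [folklore] -/
theorem signedTypeI_coeff_abs_le {k : ℕ} (S : Finset (Fin k)) {y : ℝ} (hy : 1 ≤ y)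
    (d : Fin k → ℕ) (hd : d ∈ Fintype.piFinset (fun _ : Fin k => Icc 1 ⌊y⌋₊)) :
    |(∏ i, (ArithmeticFunction.moebius (d i) : ℝ)) * ∏ i ∈ univ \ S, Real.log (d i)|
      ≤ (1 + Real.log y) ^ k := by
  have hd' : ∀ i, 1 ≤ d i ∧ d i ≤ ⌊y⌋₊ := fun i => mem_Icc.mp (Fintype.mem_piFinset.mp hd i)
  rw [abs_mul, Finset.abs_prod, Finset.abs_prod]
  have hμ : ∏ i, |(ArithmeticFunction.moebius (d i) : ℝ)| ≤ 1 := by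
    refine Finset.prod_le_one (fun i _ => abs_nonneg _) fun i _ => ?_
    rw [← Int.cast_abs]
    exact_mod_cast ArithmeticFunction.abs_moebius_le_one
  have hlog : ∏ i ∈ univ \ S, |Real.log (d i)| ≤ (1 + Real.log y) ^ k := by
    have hly : 0 ≤ Real.log y := Real.log_nonneg hy
    calc ∏ i ∈ univ \ S, |Real.log (d i)| ≤ ∏ i ∈ univ \ S, (1 + Real.log y) := by
          refine Finset.prod_le_prod (fun i _ => abs_nonneg _) fun i _ => ?_
          have h1 : (1 : ℝ) ≤ d i := by exact_mod_cast (hd' i).1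
          have h2 : (d i : ℝ) ≤ y := le_trans (by exact_mod_cast (hd' i).2) (Nat.floor_le (by linarith))
          rw [abs_of_nonneg (Real.log_nonneg h1)]
          linarith [Real.log_le_log (by linarith) h2]
      _ = (1 + Real.log y) ^ (univ \ S).card := Finset.prod_const _
      _ ≤ (1 + Real.log y) ^ k := by
          refine pow_le_pow_right₀ (by linarith) ?_
          exact (Finset.card_le_univ _).trans_eq (Fintype.card_fin k)
  calc (∏ i, |(ArithmeticFunction.moebius (d i) : ℝ)|) * ∏ i ∈ univ \ S, |Real.log (d i)|
      ≤ 1 * (1 + Real.log y) ^ k :=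
        mul_le_mul hμ hlog (Finset.prod_nonneg fun i _ => abs_nonneg _) zero_le_one
    _ = (1 + Real.log y) ^ k := one_mul _

/-- Periodicity of the divisibility pattern: `dᵢ ∣ fᵢ(n + ∏ dⱼ) ↔ dᵢ ∣ fᵢ(n)`. [folklore] -/
theorem signedTypeI_periodic {k : ℕ} (f : Fin k → ℤ[X]) (d : Fin k → ℕ) (n : ℕ) :
    (∀ i, ((d i : ℕ) : ℤ) ∣ (f i).eval ((n + ∏ i, d i : ℕ) : ℤ)) ↔
      ∀ i, ((d i : ℕ) : ℤ) ∣ (f i).eval (n : ℤ) := by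
  refine forall_congr' fun i => dvd_iff_dvd_of_dvd_sub ?_
  refine dvd_trans ?_ (Polynomial.sub_dvd_eval_sub _ _ _)
  push_cast
  rw [add_sub_cancel_left, ← Nat.cast_prod, Int.natCast_dvd_natCast]
  exact Finset.dvd_prod_of_mem _ (Finset.mem_univ i)

/-- **Stub `stub_signedTypeI_of_kernel`.** The kernel bound for all Bateman–Horn systems and non-empty `S` implies that the signed Type-I sums with a bare Möbius factor are `o(x)` at every cut-off `x^{1-η}`, `η ∈ (1/2, 1)`. [folklore] -/
theorem stub_signedTypeI_of_kernel :
    (∀ (k : ℕ) (f : Fin k → ℤ[X]),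
      Literature.NumberTheory.Sieve.IsBatemanHornSystem f → ∀ S : Finset (Fin k), S.Nonempty →
        ∃ C : ℝ, ∀ y : ℝ, 2 ≤ y →
          |∑ d ∈ Fintype.piFinset (fun _ : Fin k => Finset.Icc 1 ⌊y⌋₊),
              if ∏ i, (d i : ℝ) ≤ y then
                (∏ i, (ArithmeticFunction.moebius (d i) : ℝ)) * (∏ i ∈ Finset.univ \ S, Real.log (d i)) *
                  ((((Finset.range (∏ i, d i)).filter
                      (fun n : ℕ => ∀ i, ((d i : ℕ) : ℤ) ∣ (f i).eval (n : ℤ))).card : ℝ) / ∏ i, (d i : ℝ))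
              else 0|
            ≤ C / Real.log y ^ (S.card + 1)) →
    ∀ (k : ℕ) (f : Fin k → ℤ[X]),
      Literature.NumberTheory.Sieve.IsBatemanHornSystem f → ∀ η : ℝ, 1 / 2 < η → η < 1 →
        ∀ S : Finset (Fin k), S.Nonempty →
          (fun x : ℕ => ∑ n ∈ Finset.Icc 1 x,
            (∏ i ∈ S, Real.log ((((f i).eval (n : ℤ)).toNat : ℝ))) *
              ∑ d ∈ Fintype.piFinset (fun i => (((f i).eval (n : ℤ)).toNat).divisors),
                if ∏ i, (d i : ℝ) ≤ (x : ℝ) ^ (1 - η) then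
                  (∏ i, (ArithmeticFunction.moebius (d i) : ℝ)) * ∏ i ∈ Finset.univ \ S, Real.log (d i)
                else 0)
          =o[atTop] fun x : ℕ => (x : ℝ) := by
  intro hK k f hf η hη1 hη2 S hS
  obtain ⟨C, hC⟩ := hK k f hf S hS
  obtain ⟨N₀, hN₀3, h2, hmono⟩ := signedTypeI_threshold hf
  obtain ⟨K, hKlog⟩ := signedTypeI_log_toNat_eval_le f
  have hη0 : 0 < 1 - η := by linarith
  set W : ℕ → ℝ := fun n => ∏ i ∈ S, Real.log ((((f i).eval (n : ℤ)).toNat : ℕ) : ℝ) with hW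
  set w : (Fin k → ℕ) → ℝ := fun d =>
    (∏ i, (ArithmeticFunction.moebius (d i) : ℝ)) * ∏ i ∈ univ \ S, Real.log (d i) with hw
  set B₀ : ℝ := ∑ n ∈ range N₀, |W n| *
    ∑ d ∈ Fintype.piFinset (fun i => (((f i).eval (n : ℤ)).toNat).divisors), |w d| with hB₀
  set C₃ : ℝ := C * (K : ℝ) ^ S.card / (1 - η) ^ (S.card + 1) with hC₃
  set C₄ : ℝ := 4 * (K : ℝ) ^ S.card * 2 ^ (2 * k) with hC₄
  have hWnn : ∀ n, 0 ≤ W n := fun n => Finset.prod_nonneg fun i _ => Real.log_natCast_nonneg _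
  have hWmono : ∀ m n, N₀ ≤ m → m ≤ n → W m ≤ W n := by
    intro m n hm hmn
    refine Finset.prod_le_prod (fun i _ => Real.log_natCast_nonneg _) fun i _ => ?_
    refine Real.log_le_log (by exact_mod_cast (by linarith [h2 m hm i])) ?_
    exact_mod_cast Int.toNat_le_toNat (hmono i m n hm hmn)
  have hWle : ∀ n, 2 ≤ n → W n ≤ ((K : ℝ) * Real.log n) ^ S.card := by
    intro n hn
    refine (Finset.prod_le_prod (fun i _ => Real.log_natCast_nonneg _) fun i _ => hKlog n hn i).trans_eq ?_
    rw [Finset.prod_const]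
  refine IsBigO.trans_isLittleO ?_
    (isLittleO_model B₀ C₃ C₄ (S.card + 2 * k) (by linarith : 2 - 2 * η < 1))
  refine IsBigO.of_bound 1 ?_
  have hy_tend : Tendsto (fun x : ℕ => (x : ℝ) ^ (1 - η)) atTop atTop :=
    (tendsto_rpow_atTop hη0).comp tendsto_natCast_atTop_atTop
  filter_upwards [eventually_ge_atTop N₀, hy_tend.eventually_ge_atTop 2] with x hx hy2
  simp only [Real.norm_eq_abs, one_mul]
  set y : ℝ := (x : ℝ) ^ (1 - η) with hy
  change |∑ n ∈ Icc 1 x, W n *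
      ∑ d ∈ Fintype.piFinset (fun i => (((f i).eval (n : ℤ)).toNat).divisors),
        (if ∏ i, (d i : ℝ) ≤ y then w d else 0)|
    ≤ |B₀ + C₃ * ((x : ℝ) / Real.log x) + C₄ * (Real.log x ^ (S.card + 2 * k) * (x : ℝ) ^ (2 - 2 * η))|
  refine le_trans ?_ (le_abs_self _)
  have hx3 : 3 ≤ x := hN₀3.trans hx
  have hx0 : (0 : ℝ) < x := by exact_mod_cast (by omega : 0 < x)
  have hx3R : (3 : ℝ) ≤ x := by exact_mod_cast hx3
  have hlogx1 : 1 ≤ Real.log x := by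
    rw [Real.le_log_iff_exp_le hx0]
    linarith [Real.exp_one_lt_d9]
  have hlogy : Real.log y = (1 - η) * Real.log x := by rw [hy, Real.log_rpow hx0]
  have hy1 : 1 ≤ y := by linarith
  have hlogyle : Real.log y ≤ Real.log x := by rw [hlogy]; nlinarith
  have hlogy2 : 1 + Real.log y ≤ 2 * Real.log x := by linarith
  have hlogy0 : 0 ≤ Real.log y := Real.log_nonneg hy1
  have hyy : y * y = (x : ℝ) ^ (2 - 2 * η) := by
    rw [hy, ← Real.rpow_add hx0]; ring_nf
  -- 1. split off the initial segment `n < N₀`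
  rw [← Finset.sum_filter_add_sum_filter_not (Icc 1 x) (fun n => n < N₀)]
  have hIcc : (Icc 1 x).filter (fun n => ¬n < N₀) = Icc N₀ x := by
    ext n
    simp only [Finset.mem_filter, mem_Icc, not_lt]
    omega
  rw [hIcc]
  have hI : |∑ n ∈ (Icc 1 x).filter (fun n => n < N₀), W n *
      ∑ d ∈ Fintype.piFinset (fun i => (((f i).eval (n : ℤ)).toNat).divisors),
        (if ∏ i, (d i : ℝ) ≤ y then w d else 0)| ≤ B₀ := by
    refine signedTypeI_initial_le (fun n y' => W n *
      ∑ d ∈ Fintype.piFinset (fun i => (((f i).eval (n : ℤ)).toNat).divisors),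
        (if ∏ i, (d i : ℝ) ≤ y' then w d else 0)) _ (fun n y' => ?_) N₀ x y
    rw [abs_mul]
    refine mul_le_mul_of_nonneg_left ?_ (abs_nonneg _)
    refine (Finset.abs_sum_le_sum_abs _ _).trans (Finset.sum_le_sum fun d _ => ?_)
    split_ifs
    · exact le_rfl
    · rw [abs_zero]; exact abs_nonneg _
  -- 2. for `n ≥ N₀` the inner sums live on the fixed box
  have hM : ∑ n ∈ Icc N₀ x, W n *
      ∑ d ∈ Fintype.piFinset (fun i => (((f i).eval (n : ℤ)).toNat).divisors),
        (if ∏ i, (d i : ℝ) ≤ y then w d else 0)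
      = ∑ n ∈ Icc N₀ x, W n * ∑ d ∈ Fintype.piFinset (fun _ : Fin k => Icc 1 ⌊y⌋₊),
        if ∏ i, (d i : ℝ) ≤ y then
          w d * (if (∀ i, ((d i : ℕ) : ℤ) ∣ (f i).eval (n : ℤ)) then 1 else 0) else 0 := by
    refine Finset.sum_congr rfl fun n hn => ?_
    rw [signedTypeI_divisor_sum_eq f w (fun i => ?_) y]
    have := h2 n (mem_Icc.mp hn).1 i
    omega
  rw [hM]
  -- 3. swap the sums and use periodicity; kernel bound; error collection
  have hcore := core_estimate W w (fun d n => ∀ i, ((d i : ℕ) : ℤ) ∣ (f i).eval (n : ℤ)) hx y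
    (fun n _ => hWnn n) hWmono (fun d n => signedTypeI_periodic f d n)
  have hV := hC y hy2
  have hR := box_error_sum_le w
    (fun d => ((range (∏ i, d i)).filter (fun n : ℕ => ∀ i, ((d i : ℕ) : ℤ) ∣ (f i).eval (n : ℤ))).card)
    hy1 (by positivity : (0 : ℝ) ≤ (1 + Real.log y) ^ k)
    (fun d hd => signedTypeI_coeff_abs_le S hy1 d hd)
    (fun d => (Finset.card_filter_le _ _).trans (Finset.card_range _).le)
  set M' := ∑ n ∈ Icc N₀ x, W n * ∑ d ∈ Fintype.piFinset (fun _ : Fin k => Icc 1 ⌊y⌋₊),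
        if ∏ i, (d i : ℝ) ≤ y then
          w d * (if (∀ i, ((d i : ℕ) : ℤ) ∣ (f i).eval (n : ℤ)) then 1 else 0) else 0 with hM'
  set V := ∑ d ∈ Fintype.piFinset (fun _ : Fin k => Icc 1 ⌊y⌋₊),
        if ∏ i, (d i : ℝ) ≤ y then
          w d * ((((range (∏ i, d i)).filter
            (fun n : ℕ => ∀ i, ((d i : ℕ) : ℤ) ∣ (f i).eval (n : ℤ))).card : ℝ) / ∏ i, (d i : ℝ))
        else 0 with hVdef
  set R := ∑ d ∈ Fintype.piFinset (fun _ : Fin k => Icc 1 ⌊y⌋₊),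
        if ∏ i, (d i : ℝ) ≤ y then
          |w d| * ((((range (∏ i, d i)).filter
            (fun n : ℕ => ∀ i, ((d i : ℕ) : ℤ) ∣ (f i).eval (n : ℤ))).card : ℕ) : ℝ)
        else 0 with hRdef
  set X := ∑ n ∈ Icc N₀ x, W n with hX
  have hcore' : |M' - X * V| ≤ 4 * W x * R := hcore
  have hV' : |V| ≤ C / Real.log y ^ (S.card + 1) := hV
  have hR' : R ≤ (1 + Real.log y) ^ k * (y * (y * (1 + Real.log y) ^ k)) := hR
  have hR0 : 0 ≤ R := Finset.sum_nonneg fun d _ => by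
    split_ifs
    · positivity
    · exact le_rfl
  have hX0 : 0 ≤ X := Finset.sum_nonneg fun n _ => hWnn n
  have hWx : W x ≤ ((K : ℝ) * Real.log x) ^ S.card := hWle x (by omega)
  have hXle : X ≤ (x : ℝ) * ((K : ℝ) * Real.log x) ^ S.card := by
    calc X ≤ ∑ n ∈ Icc N₀ x, W x :=
          Finset.sum_le_sum fun n hn => hWmono n x (mem_Icc.mp hn).1 (mem_Icc.mp hn).2
      _ = ((Icc N₀ x).card : ℝ) * W x := by rw [Finset.sum_const, nsmul_eq_mul]
      _ ≤ (x : ℝ) * ((K : ℝ) * Real.log x) ^ S.card := by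
          refine mul_le_mul ?_ hWx (hWnn x) (Nat.cast_nonneg x)
          rw [Nat.card_Icc]
          exact_mod_cast (by omega : x + 1 - N₀ ≤ x)
  -- 4. the main term
  have hmainT : |X * V| ≤ C₃ * ((x : ℝ) / Real.log x) := by
    rw [abs_mul, abs_of_nonneg hX0]
    have hL0 : Real.log x ≠ 0 := by positivity
    calc X * |V| ≤ ((x : ℝ) * ((K : ℝ) * Real.log x) ^ S.card) * (C / Real.log y ^ (S.card + 1)) :=
          mul_le_mul hXle hV' (abs_nonneg _) (by positivity)
      _ = C₃ * ((x : ℝ) / Real.log x) := by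
          rw [hlogy, hC₃, mul_pow, mul_pow]
          field_simp
          ring
  -- 5. the error term
  have herrT : 4 * W x * R ≤ C₄ * (Real.log x ^ (S.card + 2 * k) * (x : ℝ) ^ (2 - 2 * η)) := by
    have hlk : (1 + Real.log y) ^ k ≤ (2 * Real.log x) ^ k :=
      pow_le_pow_left₀ (by linarith) hlogy2 k
    calc 4 * W x * R
        ≤ 4 * ((K : ℝ) * Real.log x) ^ S.card *
            ((1 + Real.log y) ^ k * (y * (y * (1 + Real.log y) ^ k))) :=
          mul_le_mul (mul_le_mul_of_nonneg_left hWx (by norm_num)) hR' hR0 (by positivity)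
      _ = 4 * ((K : ℝ) * Real.log x) ^ S.card *
            ((y * y) * ((1 + Real.log y) ^ k * (1 + Real.log y) ^ k)) := by ring
      _ ≤ 4 * ((K : ℝ) * Real.log x) ^ S.card *
            ((x : ℝ) ^ (2 - 2 * η) * ((2 * Real.log x) ^ k * (2 * Real.log x) ^ k)) := by
          rw [hyy]
          gcongr
      _ = C₄ * (Real.log x ^ (S.card + 2 * k) * (x : ℝ) ^ (2 - 2 * η)) := by
          rw [hC₄]; ring
  -- 6. assemble
  have hM'le : |M'| ≤ |M' - X * V| + |X * V| := by
    have h := abs_add_le (M' - X * V) (X * V)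
    rwa [sub_add_cancel] at h
  calc |(∑ n ∈ (Icc 1 x).filter (fun n => n < N₀), W n *
          ∑ d ∈ Fintype.piFinset (fun i => (((f i).eval (n : ℤ)).toNat).divisors),
            (if ∏ i, (d i : ℝ) ≤ y then w d else 0)) + M'|
      ≤ |∑ n ∈ (Icc 1 x).filter (fun n => n < N₀), W n *
          ∑ d ∈ Fintype.piFinset (fun i => (((f i).eval (n : ℤ)).toNat).divisors),
            (if ∏ i, (d i : ℝ) ≤ y then w d else 0)| + |M'| := abs_add_le _ _
    _ ≤ B₀ + (C₄ * (Real.log x ^ (S.card + 2 * k) * (x : ℝ) ^ (2 - 2 * η))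
          + C₃ * ((x : ℝ) / Real.log x)) :=
        add_le_add hI (hM'le.trans (add_le_add (hcore'.trans herrT) hmainT))
    _ = B₀ + C₃ * ((x : ℝ) / Real.log x)
          + C₄ * (Real.log x ^ (S.card + 2 * k) * (x : ℝ) ^ (2 - 2 * η)) := by ring

end Summit.Parity.BatemanHorn.Theorems.PolyMobiusTail.NaturalForm
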